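/-
Copyright: lit-balaban Phase-2 proof seat p33 (gen 4).  Statement-level skeleton of a published paper; no proof claims beyond what
the kernel checks below.
-/
import Literature.MathematicalPhysics.QuantumFieldTheory.BalabanImbrieJaffe1984to88.BIJ85Eq611Torus
import Literature.MathematicalPhysics.QuantumFieldTheory.BalabanImbrieJaffe1984to88.BIJ85SigmaVariational
import Literature.MathematicalPhysics.QuantumFieldTheory.BalabanImbrieJaffe1984to88.BIJ85MomentumSymbols71

/-!
# `BalabanImbrieJaffe1984to88.BIJ85Tau1Config717` — T. Bałaban, J. Imbrie, A. Jaffe, *Renormalization of the Higgs model: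
minimizers, propagators and the stability of mean field theory*, Commun. Math. Phys. **97** (1985) 299–329 [BalabanImbrieJaffe1985]:
Sect. 7.1 pp. 322–325 — **(7.1.13), (7.1.17), (7.1.18), (7.1.25), (7.1.31) IN CONFIGURATION SPACE**: the split `σ_k = τ₁ + τ₂` with
`τ₁ = Q^e_k(I − P_∂)Q^{e*}_k`, `P_∂` the orthogonal projection onto curls, `τ₁∂ = 0`, `0 ≤ τ₂`, on seat p09's abstract carriers and
ON THE TORI (seat p30's `sigmaTorus`)

statement-level skeleton of published theorems with citation tags; proofs where landed; nothing here is a claim about the Yang–Mills mass gap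

PDF held: `paper:balaban1985-cmp97-bij-higgs-minimizers` (journal page = PDF page + 298).  Pages read as images: p. 323 [PDF 25]
(`run/shared/lean/pub/pub-balaban/t4/b2b-balaban-t4-lit2/renders/bij1985/1985-cmp97-bij-higgs-minimizers-p025-x2.png`); OCR text of
pp. 322, 324–325 [PDF 24, 26–27].

CITATION HEADER (lean-in-tree rule).  Part of the lit-balaban TYPED SKELETON (HOME `run/shared/lean/pub/lit-balaban/`), Phase-2 seat
p33 (gen 4), unit `lit-balaban-p33`; the configuration-space members of rows **C1.Eq7.1.13-7.1.19** and **C1.Eq7.1.28-7.1.31** of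
`HOME/lit-balaban-r15/ROWS-C1.md` (owner r15, referee ref-5).  The momentum-SYMBOL versions are of record and untouched: r15's
`BIJ85MomentumSymbols71` (`tau1Sym`, `tau1Sym_curl`, and the ABSTRACT operator statement `eq7118` of (7.1.17)–(7.1.18) with hypotheses
`P_∂∂ = ∂` and `Q^{e*}_k∂ = ∂Q^{s*}_k` — INSTANTIATED here), seat p10's `BIJ85Tau0Positivity729`/`BIJ85CurlComplement719`/`BIJ85Prop712Fibre`
(fibrewise `tau1_form_curl`, `eq7131`, `tau1_form_reduce`) and `BIJ85Eq7113Derivation*` ((7.1.12) ⟹ (7.1.13)–(7.1.16) at a fibre).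
Companion of seat p09's `BIJ85SigmaForm421` (`sigmaOp` = (4.2.2), `curlG` = `∂G_{k,Ax}∂^*` with `curlG_idem`/`curlG_symm`/`curlG_apply_curl`/
`curlG_mem_range`), seat p30's `BIJ85Sigma421Torus` (`sigmaTorus`, `QesOp`) and `BIJ85Eq611Torus` (gen 5: the operator identity
`curlOp_QsE : ∂ ∘ Q^{s*}_k = Q^{e*}_k ∘ ∂`, `dOne`, `QsE`), and this seat's `BIJ85NoZeroModes309Torus` (gen 2, `noZeroModes_V411_holds`) and
`BIJ85SigmaVariational` (gen 4, `⟨f, σ_kf⟩ = inf_{Q_kA = 0}‖∂A − Q^{e*}_kf‖²_η`).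

THE PRINTED TEXT (verbatim).  p. 322 [PDF 24]: *"We express σ_k as a sum of two terms σ_k = τ₁ + τ₂. (7.1.13) Here τ₁ vanishes on
curls. Thus if f = ∂B, then τ₁f = 0."*; p. 323 [PDF 25]: *"In both τ₁ and τ₂ the expressions inside brackets [ ] are projection
operators. … The fact that τ₁ vanishes on curls can be established as follows: The general form of τ₁ in configuration space is evident
from (7.1.11), (7.1.14) namely τ₁ = Q^e_k(I − P_∂)Q^{e*}_k, (7.1.17) where P_∂ denotes the orthogonal projection onto curls. (If P₁
projects one-forms onto gradients, then P₁⊗P₁ projects two forms onto curls.) Furthermore Q^{e*}_k∂ = ∂Q^{s*}_k, so τ₁∂ = Q^e_k(I −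
P_∂)∂Q^{s*}_k = 0. (7.1.18)"*; p. 324 [PDF 26]: *"For f = ∂B + f^⊥ write ⟨f, σ_kf⟩ = ⟨f^⊥, τ₁f^⊥⟩ + ⟨f, τ₂f⟩ ≥ … (7.1.25) Here we use
τ₁∂ = 0 and the hypothesis on τ₁. … In fact, 0 ≤ τ₂ is evident from (7.1.15)."*; p. 325 [PDF 27]: *"But since τ₁∂ = 0, ⟨∂B, τ₂∂B⟩ =
⟨∂B, σ_k∂B⟩ = ⟨B, Δ_kB⟩, (7.1.31) using the definition (4.3.1) of Δ_k."*; p. 311 [PDF 13]: *"∂G_{k,Ax}∂^* is a projection operator"*.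

TYPED READING.  In p09's Euclidean encoding (`E` = η-bond fields, `F` = η-plaquette fields, `F′` = unit-lattice plaquette fields,
`D = ∂`, `Qes = Q^{e*}_k`, `Q^e_k` = the Euclidean adjoint of `Qes`, constraint subspace `V`): `P_∂ := (range ∂).starProjection` (Mathlib's
orthogonal projection; ALL curls `∂A`, no constraint on `A`) = `projCurl D`; **(7.1.17)** `tau1Op D Qes := Q^e_k ∘ (I − P_∂) ∘ Q^{e*}_k`;
**(7.1.13)** then DEFINES τ₂ in configuration space, `tau2Op V D Qes := Q^e_k ∘ (P_∂ − ∂G_{k,Ax}∂^*) ∘ Q^{e*}_k`, `σ_k = τ₁ + τ₂`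
(`sigmaOp_eq_tau1Op_add_tau2Op`).  The parenthetical *"P₁⊗P₁"* is a momentum-space description of `P_∂` and is not used.
WHAT IS PROVED (3 definitions with bodies, theorems; no `Prop`-valued definition, no new named fact — D-0026).
* §1 ABSTRACT: `P_∂` fixes curls, is symmetric and idempotent, `‖g − P_∂g‖ = inf_A‖g − ∂A‖` (`norm_sub_projCurl_eq_iInf`, Mathlib's
  `starProjection_minimal`); p. 311 SHARPENED: **`∂G_{k,Ax}∂^*` IS the orthogonal projection onto `∂V`** (`curlG_eq_starProjection`);
  **(7.1.13)** `sigmaOp = tau1Op + tau2Op`; **(7.1.18)** `tau1Op ∘ ∂ = 0` for every unit-lattice curl `∂ = d1` with `Q^{e*}_k ∘ d1 =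
  ∂ ∘ Q^{s*}_k` — r15's `eq7118` with BOTH hypotheses discharged (`tau1Op_comp_eq_zero`; pointwise `tau1Op_apply_eq_zero_of_mem`: τ₁
  kills every `f` with `Q^{e*}_kf` a curl); the forms: **`⟨f, τ₁f⟩ = ‖(I − P_∂)Q^{e*}_kf‖² = inf over ALL η-bond fields A of ‖∂A −
  Q^{e*}_kf‖²`** (`inner_tau1Op_eq_norm_sq`, `inner_tau1Op_le`, `exists_eq_inner_tau1Op`, `inner_tau1Op_eq_iInf` — the UNCONSTRAINED
  variational problem, versus the constrained one `⟨f, σ_kf⟩ = inf_{v ∈ V}` of `BIJ85SigmaVariational`), **`0 ≤ ⟨f, τ₂f⟩ = ‖(P_∂ −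
  ∂G_{k,Ax}∂^*)Q^{e*}_kf‖²`** (`inner_tau2Op_eq_norm_sq`, `inner_tau2Op_nonneg`; p. 324 *"0 ≤ τ₂"*), hence `⟨f, τ₂f⟩ = inf_{v∈V}‖∂v −
  Q^{e*}_kf‖² − inf_A‖∂A − Q^{e*}_kf‖²` (`inner_tau2Op_eq_iInf_sub_iInf`: τ₂ is the cost of the constraint), `τ₁, τ₂` symmetric,
  `⟨f, τ₁f⟩ ≤ ⟨f, σ_kf⟩`; **(7.1.25)**, first step: `⟨∂B + g, σ_k(∂B + g)⟩ = ⟨g, τ₁g⟩ + ⟨∂B + g, τ₂(∂B + g)⟩` (`eq7125_split`);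
  **(7.1.31)** `σ_k∂B = τ₂∂B` (`sigmaOp_apply_of_tau1_zero`).
* §2 ON THE TORI (`sigmaTorus hd w c k`; standing range `k ≤ m + K`, `w > 0`, `c ≠ 0`, `2 ≤ d`): `tau1Torus`, `tau2Torus`,
  `sigmaTorus_eq_tau1_add_tau2` ((7.1.13)); **(7.1.18) AS AN OPERATOR IDENTITY ON THE TORI `tau1Torus ∘ dOne = 0`** (`tau1Torus_comp_dOne`,
  from p30's `curlOp_QsE`; pointwise `tau1Torus_curl`: τ₁(∂B) = 0 for every unit-lattice bond function `B`); `⟨f, τ₁f⟩ = inf_A ‖√w·∂A −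
  √w·Q^{e*}_kf‖²` over ALL η-bond fields (`inner_tau1Torus_eq_iInf`), `0 ≤ ⟨f, τ₂f⟩` (`inner_tau2Torus_nonneg`, no zero modes), `⟨f, τ₂f⟩
  = inf_{Q_kA=0} − inf_A` (`inner_tau2Torus_eq_iInf_sub_iInf`), `⟨f, τ₁f⟩ ≤ ⟨f, σ_kf⟩`; **(7.1.31) verbatim on the tori**: `⟨∂B, τ₂∂B⟩ =
  ⟨∂B, σ_k∂B⟩ = ⟨B, Δ_kB⟩` (`inner_tau2Torus_curl`, `inner_tau2Torus_curl_eq_deltaTorus`, Δ_k = p30's `deltaTorus` of (4.3.1)).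
HONEST SCOPE.  Not claimed: that the momentum symbol of THIS configuration-space `τ₂` is (7.1.15) (seat p10's `BIJ85Eq7113Derivation*`
with seat p27's dictionary), the decomposition (7.1.19) for the product (7.1.19b) and the bounds (7.1.21)–(7.1.30) (seats p10/r15,
fibrewise).  Unit `lit-balaban-p33` (literature-prover-lit-balaban-p33-g4-0), 2026-08-21.
-/

open scoped BigOperators RealInnerProductSpace

namespace Literature.MathematicalPhysics.QuantumFieldTheory.BalabanImbrieJaffe1984to88.BIJ85Tau1Config717

open BIJ85AxialPropagator411 BIJ85SigmaForm421 BIJ85Sigma421Torus BIJ85NoZeroModes309Torus BIJ85MomentumSymbols71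
  BIJ85SigmaVariational

noncomputable section

/-! ## 1. Abstract: `P_∂`, `τ₁ = Q^e_k(I − P_∂)Q^{e*}_k`, `τ₂ = Q^e_k(P_∂ − ∂G_{k,Ax}∂^*)Q^{e*}_k` -/

section Abstract

variable {E F F' : Type*} [NormedAddCommGroup E] [InnerProductSpace ℝ E] [FiniteDimensional ℝ E]
  [NormedAddCommGroup F] [InnerProductSpace ℝ F] [NormedAddCommGroup F'] [InnerProductSpace ℝ F']

/-- **`P_∂`**, *"the orthogonal projection onto curls"* (onto `range ∂`, all η-bond fields admitted), as a linear map.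
[cite: BalabanImbrieJaffe1985, (7.1.17) p.323] -/
def projCurl (D : E →ₗ[ℝ] F) : F →ₗ[ℝ] F :=
  ((LinearMap.range D).starProjection : F →L[ℝ] F).toLinearMap

/-- Unfolding `P_∂`. [cite: BalabanImbrieJaffe1985, (7.1.17) p.323] -/
theorem projCurl_apply (D : E →ₗ[ℝ] F) (g : F) : projCurl D g = (LinearMap.range D).starProjection g := rfl

/-- `P_∂` fixes curls: `P_∂∂A = ∂A` (hypothesis `hP` of r15's `eq7118`). [cite: BalabanImbrieJaffe1985, (7.1.18) p.323] -/
theorem projCurl_apply_curl (D : E →ₗ[ℝ] F) (A : E) : projCurl D (D A) = D A :=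
  Submodule.starProjection_eq_self_iff.mpr (LinearMap.mem_range_self D A)

/-- `P_∂ ∘ ∂ = ∂`. [cite: BalabanImbrieJaffe1985, (7.1.18) p.323] -/
theorem projCurl_comp (D : E →ₗ[ℝ] F) : projCurl D ∘ₗ D = D :=
  LinearMap.ext (projCurl_apply_curl D)

/-- `P_∂g` is a curl. [cite: BalabanImbrieJaffe1985, (7.1.17) p.323] -/
theorem projCurl_mem_range (D : E →ₗ[ℝ] F) (g : F) : projCurl D g ∈ LinearMap.range D :=
  Submodule.starProjection_apply_mem _ g

/-- `P_∂` is symmetric. [cite: BalabanImbrieJaffe1985, (7.1.17) p.323] -/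
theorem projCurl_symm (D : E →ₗ[ℝ] F) (g h : F) : ⟪projCurl D g, h⟫ = ⟪g, projCurl D h⟫ :=
  Submodule.inner_starProjection_left_eq_right _ g h

/-- `P_∂` is idempotent. [cite: BalabanImbrieJaffe1985, (7.1.17) p.323] -/
theorem projCurl_idem (D : E →ₗ[ℝ] F) (g : F) : projCurl D (projCurl D g) = projCurl D g :=
  Submodule.starProjection_eq_self_iff.mpr (projCurl_mem_range D g)

/-- `g − P_∂g` is orthogonal to the curls. [cite: BalabanImbrieJaffe1985, (7.1.17) p.323] -/
theorem inner_sub_projCurl_of_mem (D : E →ₗ[ℝ] F) (g : F) {h : F} (hh : h ∈ LinearMap.range D) : ⟪g - projCurl D g, h⟫ = 0 :=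
  Submodule.starProjection_inner_eq_zero g h hh

/-- `g − P_∂g` is orthogonal to every curl `∂A`. [cite: BalabanImbrieJaffe1985, (7.1.17) p.323] -/
theorem inner_sub_projCurl_curl (D : E →ₗ[ℝ] F) (g : F) (A : E) : ⟪g - projCurl D g, D A⟫ = 0 :=
  inner_sub_projCurl_of_mem D g (LinearMap.mem_range_self D A)

/-- **`P_∂` is the nearest-curl map**: `‖g − P_∂g‖ = inf_A ‖g − ∂A‖` over ALL η-bond fields `A`. [cite: BalabanImbrieJaffe1985, (7.1.17) p.323] -/
theorem norm_sub_projCurl_eq_iInf (D : E →ₗ[ℝ] F) (g : F) : ‖g - projCurl D g‖ = ⨅ A : E, ‖g - D A‖ := by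
  rw [projCurl_apply, Submodule.starProjection_minimal]
  exact ((LinearMap.surjective_rangeRestrict D).iInf_comp fun x : LinearMap.range D => ‖g - (x : F)‖).symm

/-- Pythagoras for `P_∂`: `‖g − ∂A‖² = ‖g − P_∂g‖² + ‖P_∂g − ∂A‖²`. [cite: BalabanImbrieJaffe1985, (7.1.17) p.323] -/
theorem norm_sub_curl_sq_eq (D : E →ₗ[ℝ] F) (g : F) (A : E) :
    ‖g - D A‖ ^ 2 = ‖g - projCurl D g‖ ^ 2 + ‖projCurl D g - D A‖ ^ 2 := by
  have horth : ⟪g - projCurl D g, projCurl D g - D A⟫ = 0 :=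
    inner_sub_projCurl_of_mem D g (Submodule.sub_mem _ (projCurl_mem_range D g) (LinearMap.mem_range_self D A))
  have hsplit : g - D A = (g - projCurl D g) + (projCurl D g - D A) := by abel
  rw [hsplit, norm_add_sq_real, horth, mul_zero, add_zero]

variable [FiniteDimensional ℝ F] [FiniteDimensional ℝ F']

/-- **p. 311 sharpened: `∂G_{k,Ax}∂^*` IS the orthogonal projection onto the curls `∂V` of constraint fields** (no zero modes of `∂`
on `V`; p09 proved idempotence, symmetry and range). [cite: BalabanImbrieJaffe1985, (4.2.2) p.311] -/
theorem curlG_eq_starProjection_apply {V : Submodule ℝ E} {D : E →ₗ[ℝ] F} (hD : ∀ v : V, D (v : E) = 0 → v = 0) (g : F) :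
    curlG V D g = (V.map D).starProjection g := by
  symm
  apply Submodule.eq_starProjection_of_mem_orthogonal
  · obtain ⟨v, hv⟩ := curlG_mem_range V D g
    rw [hv]
    exact Submodule.mem_map_of_mem v.2
  · rw [Submodule.mem_orthogonal]
    intro u hu
    obtain ⟨v', hv', rfl⟩ := Submodule.mem_map.mp hu
    have hfix := curlG_apply_curl hD ⟨v', hv'⟩
    rw [Submodule.coe_mk] at hfix
    rw [inner_sub_right, ← curlG_symm hD, hfix, sub_self]

/-- The same as an identity of linear maps. [cite: BalabanImbrieJaffe1985, (4.2.2) p.311] -/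
theorem curlG_eq_starProjection {V : Submodule ℝ E} {D : E →ₗ[ℝ] F} (hD : ∀ v : V, D (v : E) = 0 → v = 0) :
    curlG V D = ((V.map D).starProjection : F →L[ℝ] F).toLinearMap :=
  LinearMap.ext (curlG_eq_starProjection_apply hD)

/-- `P_∂` fixes the range of `∂G_{k,Ax}∂^*` (curls of constraint fields are curls). [cite: BalabanImbrieJaffe1985, (7.1.17) p.323] -/
theorem projCurl_curlG (V : Submodule ℝ E) (D : E →ₗ[ℝ] F) (g : F) : projCurl D (curlG V D g) = curlG V D g := by
  obtain ⟨v, hv⟩ := curlG_mem_range V D g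
  rw [hv, projCurl_apply_curl]

/-- **(7.1.17)**: `τ₁ = Q^e_k(I − P_∂)Q^{e*}_k` in configuration space (`Q^e_k` the Euclidean adjoint of `Qes = Q^{e*}_k`).
[cite: BalabanImbrieJaffe1985, (7.1.17) p.323] -/
def tau1Op (D : E →ₗ[ℝ] F) (Qes : F' →ₗ[ℝ] F) : F' →ₗ[ℝ] F' :=
  LinearMap.adjoint Qes ∘ₗ (LinearMap.id - projCurl D) ∘ₗ Qes

/-- **τ₂ in configuration space**, as forced by (7.1.12)–(7.1.13) and (7.1.17): `τ₂ = σ_k − τ₁ = Q^e_k(P_∂ − ∂G_{k,Ax}∂^*)Q^{e*}_k`.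
[cite: BalabanImbrieJaffe1985, (7.1.13) p.322] -/
def tau2Op (V : Submodule ℝ E) (D : E →ₗ[ℝ] F) (Qes : F' →ₗ[ℝ] F) : F' →ₗ[ℝ] F' :=
  LinearMap.adjoint Qes ∘ₗ (projCurl D - curlG V D) ∘ₗ Qes

/-- **(7.1.13)**, verbatim: *"We express σ_k as a sum of two terms σ_k = τ₁ + τ₂. (7.1.13)"* — for p09's operator (4.2.2)/(7.1.12).
[cite: BalabanImbrieJaffe1985, (7.1.13) p.322] -/
theorem sigmaOp_eq_tau1Op_add_tau2Op (V : Submodule ℝ E) (D : E →ₗ[ℝ] F) (Qes : F' →ₗ[ℝ] F) :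
    sigmaOp V D Qes = tau1Op D Qes + tau2Op V D Qes := by
  unfold sigmaOp tau1Op tau2Op
  rw [← LinearMap.comp_add, ← LinearMap.add_comp, sub_add_sub_cancel]

/-- **τ₁ kills every `f` whose `Q^{e*}_kf` is a curl** (the mechanism of (7.1.18)). [cite: BalabanImbrieJaffe1985, (7.1.18) p.323] -/
theorem tau1Op_apply_eq_zero_of_mem (D : E →ₗ[ℝ] F) (Qes : F' →ₗ[ℝ] F) {f : F'} (h : Qes f ∈ LinearMap.range D) :
    tau1Op D Qes f = 0 := by
  simp only [tau1Op, LinearMap.comp_apply, LinearMap.sub_apply, LinearMap.id_apply, projCurl_apply,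
    Submodule.starProjection_eq_self_iff.mpr h, sub_self, map_zero]

/-- **(7.1.18)**, verbatim: *"Furthermore Q^{e*}_k∂ = ∂Q^{s*}_k, so τ₁∂ = Q^e_k(I − P_∂)∂Q^{s*}_k = 0. (7.1.18)"* — r15's abstract
`BIJ85MomentumSymbols71.eq7118` with its hypothesis `hP : P_∂∂ = ∂` DISCHARGED for the orthogonal projection `P_∂`; `d1` = the
unit-lattice curl, `Qss = Q^{s*}_k`, `hQ` the printed `Q^{e*}_k∂ = ∂Q^{s*}_k`. [cite: BalabanImbrieJaffe1985, (7.1.18) p.323] -/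
theorem tau1Op_comp_eq_zero (D : E →ₗ[ℝ] F) (Qes : F' →ₗ[ℝ] F) {A1 : Type*} [AddCommGroup A1] [Module ℝ A1]
    (d1 : A1 →ₗ[ℝ] F') (Qss : A1 →ₗ[ℝ] E) (hQ : Qes ∘ₗ d1 = D ∘ₗ Qss) : tau1Op D Qes ∘ₗ d1 = 0 :=
  eq7118 (LinearMap.adjoint Qes) Qes Qss d1 D (projCurl D) (projCurl_comp D) hQ

/-- (7.1.18) pointwise: *"Thus if f = ∂B, then τ₁f = 0"* (p. 322). [cite: BalabanImbrieJaffe1985, (7.1.13) p.322] -/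
theorem tau1Op_apply_curl (D : E →ₗ[ℝ] F) (Qes : F' →ₗ[ℝ] F) {A1 : Type*} [AddCommGroup A1] [Module ℝ A1]
    (d1 : A1 →ₗ[ℝ] F') (Qss : A1 →ₗ[ℝ] E) (hQ : Qes ∘ₗ d1 = D ∘ₗ Qss) (B : A1) : tau1Op D Qes (d1 B) = 0 := by
  have h := LinearMap.congr_fun (tau1Op_comp_eq_zero D Qes d1 Qss hQ) B
  rwa [LinearMap.comp_apply, LinearMap.zero_apply] at h

/-- **The form of τ₁**: `⟨f, τ₁f⟩ = ‖(I − P_∂)Q^{e*}_kf‖²`. [cite: BalabanImbrieJaffe1985, (7.1.17) p.323] -/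
theorem inner_tau1Op_eq_norm_sq (D : E →ₗ[ℝ] F) (Qes : F' →ₗ[ℝ] F) (f : F') :
    ⟪f, tau1Op D Qes f⟫ = ‖Qes f - projCurl D (Qes f)‖ ^ 2 := by
  have h0 : ⟪Qes f - projCurl D (Qes f), projCurl D (Qes f)⟫ = 0 :=
    inner_sub_projCurl_of_mem D (Qes f) (projCurl_mem_range D (Qes f))
  simp only [tau1Op, LinearMap.comp_apply, LinearMap.adjoint_inner_right, LinearMap.sub_apply, LinearMap.id_apply]
  rw [← real_inner_self_eq_norm_sq, inner_sub_right (Qes f - projCurl D (Qes f)), h0, sub_zero, real_inner_comm]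

/-- `τ₁` is symmetric. [cite: BalabanImbrieJaffe1985, (7.1.17) p.323] -/
theorem tau1Op_symm (D : E →ₗ[ℝ] F) (Qes : F' →ₗ[ℝ] F) (f g : F') : ⟪tau1Op D Qes f, g⟫ = ⟪f, tau1Op D Qes g⟫ := by
  simp only [tau1Op, LinearMap.comp_apply, LinearMap.adjoint_inner_left, LinearMap.adjoint_inner_right, LinearMap.sub_apply,
    LinearMap.id_apply, inner_sub_left, inner_sub_right, projCurl_symm]

/-- **`⟨f, τ₁f⟩ ≤ ‖∂A − Q^{e*}_kf‖²` for EVERY η-bond field `A`** (no block-average constraint, no gauge condition).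
[cite: BalabanImbrieJaffe1985, (7.1.17) p.323] -/
theorem inner_tau1Op_le (D : E →ₗ[ℝ] F) (Qes : F' →ₗ[ℝ] F) (f : F') (A : E) : ⟪f, tau1Op D Qes f⟫ ≤ ‖D A - Qes f‖ ^ 2 := by
  rw [inner_tau1Op_eq_norm_sq, norm_sub_rev (D A), norm_sub_curl_sq_eq D (Qes f) A]
  exact le_add_of_nonneg_right (sq_nonneg _)

/-- … with equality attained (at any `A` with `∂A = P_∂Q^{e*}_kf`). [cite: BalabanImbrieJaffe1985, (7.1.17) p.323] -/
theorem exists_eq_inner_tau1Op (D : E →ₗ[ℝ] F) (Qes : F' →ₗ[ℝ] F) (f : F') : ∃ A : E, ‖D A - Qes f‖ ^ 2 = ⟪f, tau1Op D Qes f⟫ := by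
  obtain ⟨A, hA⟩ := LinearMap.mem_range.mp (projCurl_mem_range D (Qes f))
  exact ⟨A, by rw [inner_tau1Op_eq_norm_sq, hA, norm_sub_rev]⟩

/-- **`⟨f, τ₁f⟩ = inf over ALL η-bond fields A of ‖∂A − Q^{e*}_kf‖²`** — the UNCONSTRAINED variational problem (the constrained one,
over `δ(Q_kA)δ_{k,Ax}`, is `⟨f, σ_kf⟩`, `BIJ85SigmaVariational.inner_sigmaOp_eq_iInf`). [cite: BalabanImbrieJaffe1985, (7.1.17) p.323] -/
theorem inner_tau1Op_eq_iInf (D : E →ₗ[ℝ] F) (Qes : F' →ₗ[ℝ] F) (f : F') : ⟪f, tau1Op D Qes f⟫ = ⨅ A : E, ‖D A - Qes f‖ ^ 2 := by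
  apply le_antisymm
  · exact le_ciInf fun A => inner_tau1Op_le D Qes f A
  · obtain ⟨A, hA⟩ := exists_eq_inner_tau1Op D Qes f
    rw [← hA]
    exact ciInf_le ⟨0, by rintro _ ⟨B, rfl⟩; positivity⟩ A

/-- **The form of τ₂**: `⟨f, τ₂f⟩ = ‖(P_∂ − ∂G_{k,Ax}∂^*)Q^{e*}_kf‖²` (nested projections, `∂V ⊆ range ∂`). [cite: BalabanImbrieJaffe1985, (7.1.13) p.322] -/
theorem inner_tau2Op_eq_norm_sq {V : Submodule ℝ E} {D : E →ₗ[ℝ] F} (hD : ∀ v : V, D (v : E) = 0 → v = 0) (Qes : F' →ₗ[ℝ] F)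
    (f : F') : ⟪f, tau2Op V D Qes f⟫ = ‖projCurl D (Qes f) - curlG V D (Qes f)‖ ^ 2 := by
  set g := Qes f with hg
  have h1 : ⟪projCurl D g, projCurl D g⟫ = ⟪g, projCurl D g⟫ := by rw [projCurl_symm, projCurl_idem]
  have h2 : ⟪projCurl D g, curlG V D g⟫ = ⟪g, curlG V D g⟫ := by rw [projCurl_symm, projCurl_curlG]
  have h3 : ⟪curlG V D g, projCurl D g⟫ = ⟪g, curlG V D g⟫ := by rw [real_inner_comm, h2]
  have h4 : ⟪curlG V D g, curlG V D g⟫ = ⟪g, curlG V D g⟫ := by rw [curlG_symm hD, curlG_idem hD]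
  simp only [tau2Op, LinearMap.comp_apply, LinearMap.adjoint_inner_right, LinearMap.sub_apply]
  rw [← hg, ← real_inner_self_eq_norm_sq, inner_sub_left, inner_sub_right, inner_sub_right, inner_sub_right, h1, h2, h3, h4]
  ring

/-- **`0 ≤ τ₂`** in configuration space (p. 324: *"In fact, 0 ≤ τ₂ is evident from (7.1.15)"*). [cite: BalabanImbrieJaffe1985, (7.1.25) p.324] -/
theorem inner_tau2Op_nonneg {V : Submodule ℝ E} {D : E →ₗ[ℝ] F} (hD : ∀ v : V, D (v : E) = 0 → v = 0) (Qes : F' →ₗ[ℝ] F)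
    (f : F') : 0 ≤ ⟪f, tau2Op V D Qes f⟫ := by
  rw [inner_tau2Op_eq_norm_sq hD]
  exact sq_nonneg _

/-- `τ₂` is symmetric. [cite: BalabanImbrieJaffe1985, (7.1.13) p.322] -/
theorem tau2Op_symm {V : Submodule ℝ E} {D : E →ₗ[ℝ] F} (hD : ∀ v : V, D (v : E) = 0 → v = 0) (Qes : F' →ₗ[ℝ] F) (f g : F') :
    ⟪tau2Op V D Qes f, g⟫ = ⟪f, tau2Op V D Qes g⟫ := by
  simp only [tau2Op, LinearMap.comp_apply, LinearMap.adjoint_inner_left, LinearMap.adjoint_inner_right, LinearMap.sub_apply,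
    inner_sub_left, inner_sub_right, projCurl_symm, curlG_symm hD]

/-- `σ_k = τ₁ + τ₂` as forms: `⟨f, σ_kf⟩ = ⟨f, τ₁f⟩ + ⟨f, τ₂f⟩`. [cite: BalabanImbrieJaffe1985, (7.1.13) p.322] -/
theorem inner_sigmaOp_eq_add (V : Submodule ℝ E) (D : E →ₗ[ℝ] F) (Qes : F' →ₗ[ℝ] F) (f : F') :
    ⟪f, sigmaOp V D Qes f⟫ = ⟪f, tau1Op D Qes f⟫ + ⟪f, tau2Op V D Qes f⟫ := by
  rw [sigmaOp_eq_tau1Op_add_tau2Op, LinearMap.add_apply, inner_add_right]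

/-- `⟨f, τ₁f⟩ ≤ ⟨f, σ_kf⟩` (unconstrained ≤ constrained minimum). [cite: BalabanImbrieJaffe1985, (7.1.13) p.322] -/
theorem inner_tau1Op_le_inner_sigmaOp {V : Submodule ℝ E} {D : E →ₗ[ℝ] F} (hD : ∀ v : V, D (v : E) = 0 → v = 0)
    (Qes : F' →ₗ[ℝ] F) (f : F') : ⟪f, tau1Op D Qes f⟫ ≤ ⟪f, sigmaOp V D Qes f⟫ := by
  rw [inner_sigmaOp_eq_add]
  exact le_add_of_nonneg_right (inner_tau2Op_nonneg hD Qes f)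

/-- **τ₂ is the cost of the constraint**: `⟨f, τ₂f⟩ = inf_{v ∈ V}‖∂v − Q^{e*}_kf‖² − inf_A‖∂A − Q^{e*}_kf‖²`.
[cite: BalabanImbrieJaffe1985, (7.1.13) p.322] -/
theorem inner_tau2Op_eq_iInf_sub_iInf {V : Submodule ℝ E} {D : E →ₗ[ℝ] F} (hD : ∀ v : V, D (v : E) = 0 → v = 0)
    (Qes : F' →ₗ[ℝ] F) (f : F') :
    ⟪f, tau2Op V D Qes f⟫ = (⨅ v : V, ‖D (v : E) - Qes f‖ ^ 2) - ⨅ A : E, ‖D A - Qes f‖ ^ 2 := by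
  rw [← inner_sigmaOp_eq_iInf hD, ← inner_tau1Op_eq_iInf, inner_sigmaOp_eq_add]
  ring

/-- **(7.1.25), first step**: for `f = ∂B + g` with `τ₁∂B = 0`, `⟨f, σ_kf⟩ = ⟨g, τ₁g⟩ + ⟨f, τ₂f⟩` (*"Here we use τ₁∂ = 0"*; in print
`g = f^⊥`). [cite: BalabanImbrieJaffe1985, (7.1.25) p.324] -/
theorem eq7125_split (V : Submodule ℝ E) (D : E →ₗ[ℝ] F) (Qes : F' →ₗ[ℝ] F) {b : F'} (hb : tau1Op D Qes b = 0) (g : F') :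
    ⟪b + g, sigmaOp V D Qes (b + g)⟫ = ⟪g, tau1Op D Qes g⟫ + ⟪b + g, tau2Op V D Qes (b + g)⟫ := by
  rw [inner_sigmaOp_eq_add, map_add, hb, zero_add, inner_add_left, ← tau1Op_symm, hb, inner_zero_left, zero_add]

/-- **(7.1.31), operator form**: `σ_k∂B = τ₂∂B` whenever `τ₁∂B = 0`. [cite: BalabanImbrieJaffe1985, (7.1.31) p.325] -/
theorem sigmaOp_apply_of_tau1_zero (V : Submodule ℝ E) (D : E →ₗ[ℝ] F) (Qes : F' →ₗ[ℝ] F) {b : F'} (hb : tau1Op D Qes b = 0) :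
    sigmaOp V D Qes b = tau2Op V D Qes b := by
  rw [sigmaOp_eq_tau1Op_add_tau2Op, LinearMap.add_apply, hb, zero_add]

end Abstract

/-! ## 2. On the tori -/

section Torus

open Literature.MathematicalPhysics.QuantumFieldTheory.Balaban1983to89
open LatticeFieldCalculus BIJ85Eq531Inputs BIJ85Prop521Torus BIJ85Eq611Torus BIJ85NoZeroModes309TorusPart2

variable {P : Params}

/-- **τ₁ = Q^e_k(I − P_∂)Q^{e*}_k ON THE TORUS** for p30's data (`∂ = curlOp w c = √w·∂`, `Q^{e*}_k = QesOp hd w k = √w·Q^{e*}_k`,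
`w = η^d`). [cite: BalabanImbrieJaffe1985, (7.1.17) p.323] -/
def tau1Torus (hd : 2 ≤ P.d) (w c : ℝ) (k : ℕ) : UnitPlaqSpace P k →ₗ[ℝ] UnitPlaqSpace P k :=
  tau1Op (curlOp (P := P) w c) (QesOp (P := P) hd w k)

/-- **τ₂ = Q^e_k(P_∂ − ∂G_{k,Ax}∂^*)Q^{e*}_k ON THE TORUS** (`V = V411 P k` = δ(Q_kA)δ_{k,Ax}). [cite: BalabanImbrieJaffe1985, (7.1.13) p.322] -/
def tau2Torus (hd : 2 ≤ P.d) (w c : ℝ) (k : ℕ) : UnitPlaqSpace P k →ₗ[ℝ] UnitPlaqSpace P k :=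
  tau2Op (V411 P k) (curlOp (P := P) w c) (QesOp (P := P) hd w k)

/-- **(7.1.13) on the torus**: `σ_k = τ₁ + τ₂` for `sigmaTorus`. [cite: BalabanImbrieJaffe1985, (7.1.13) p.322] -/
theorem sigmaTorus_eq_tau1_add_tau2 (hd : 2 ≤ P.d) (w c : ℝ) (k : ℕ) :
    sigmaTorus (P := P) hd w c k = tau1Torus hd w c k + tau2Torus hd w c k :=
  sigmaOp_eq_tau1Op_add_tau2Op _ _ _

/-- **(7.1.18) ON THE TORI as an operator identity**: `τ₁ ∘ ∂ = 0`, `∂ = dOne P k c` the unit-lattice curl of `T^{(k)}` bond fields (`hQ` of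
r15's `eq7118` := p30's `curlOp_QsE`, `∂Q^{s*}_k = Q^{e*}_k∂`; standing range `k ≤ m + K`). [cite: BalabanImbrieJaffe1985, (7.1.18) p.323] -/
theorem tau1Torus_comp_dOne (hd : 2 ≤ P.d) {k : ℕ} (hk : k ≤ P.m + P.K) (w c : ℝ) :
    tau1Torus hd w c k ∘ₗ dOne P k c = 0 :=
  tau1Op_comp_eq_zero _ _ (dOne P k c) (QsE P k) (curlOp_QsE hd hk w c).symm

/-- (7.1.18) pointwise on the tori: `τ₁(∂B) = 0` for every unit-lattice bond function `B` (*"if f = ∂B, then τ₁f = 0"*, p. 322; factor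
`c/L^k` on `T^{(k)}` against the fine factor `c`). [cite: BalabanImbrieJaffe1985, (7.1.18) p.323] -/
theorem tau1Torus_curl (hd : 2 ≤ P.d) {k : ℕ} (hk : k ≤ P.m + P.K) (w c : ℝ) (B : PBond P k → ℝ) :
    tau1Torus hd w c k (toU P k (curl (c / (P.L : ℝ) ^ k) B)) = 0 := by
  rw [← dOne_toEj]
  exact tau1Op_apply_curl _ _ (dOne P k c) (QsE P k) (curlOp_QsE hd hk w c).symm (toEj P k B)

/-- `⟨f, τ₁f⟩ ≤ ‖√w·∂A − √w·Q^{e*}_kf‖²` for EVERY η-bond field `A` on the torus. [cite: BalabanImbrieJaffe1985, (7.1.17) p.323] -/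
theorem inner_tau1Torus_le (hd : 2 ≤ P.d) (w c : ℝ) (k : ℕ) (f : UnitPlaqSpace P k) (A : VecField P 0 ℝ) :
    ⟪f, tau1Torus hd w c k f⟫ ≤ ‖curlOp (P := P) w c (toE P A) - QesOp (P := P) hd w k f‖ ^ 2 :=
  inner_tau1Op_le _ _ f (toE P A)

/-- … with equality attained. [cite: BalabanImbrieJaffe1985, (7.1.17) p.323] -/
theorem exists_eq_inner_tau1Torus (hd : 2 ≤ P.d) (w c : ℝ) (k : ℕ) (f : UnitPlaqSpace P k) :
    ∃ A : VecField P 0 ℝ, ‖curlOp (P := P) w c (toE P A) - QesOp (P := P) hd w k f‖ ^ 2 = ⟪f, tau1Torus hd w c k f⟫ := by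
  obtain ⟨A', hA'⟩ := exists_eq_inner_tau1Op (curlOp (P := P) w c) (QesOp (P := P) hd w k) f
  exact ⟨(toE P).symm A', by rwa [LinearEquiv.apply_symm_apply]⟩

/-- **`⟨f, τ₁f⟩ = inf over ALL η-bond fields A of ‖√w·∂A − √w·Q^{e*}_kf‖²` on the torus** (no `δ(Q_kA)`, no `δ_{k,Ax}`).
[cite: BalabanImbrieJaffe1985, (7.1.17) p.323] -/
theorem inner_tau1Torus_eq_iInf (hd : 2 ≤ P.d) (w c : ℝ) (k : ℕ) (f : UnitPlaqSpace P k) :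
    ⟪f, tau1Torus hd w c k f⟫ = ⨅ A : VecField P 0 ℝ, ‖curlOp (P := P) w c (toE P A) - QesOp (P := P) hd w k f‖ ^ 2 := by
  apply le_antisymm
  · exact le_ciInf fun A => inner_tau1Torus_le hd w c k f A
  · obtain ⟨A, hA⟩ := exists_eq_inner_tau1Torus hd w c k f
    have hbdd : BddBelow (Set.range fun B : VecField P 0 ℝ =>
        ‖curlOp (P := P) w c (toE P B) - QesOp (P := P) hd w k f‖ ^ 2) := ⟨0, by rintro _ ⟨B, rfl⟩; exact sq_nonneg _⟩
    exact (ciInf_le hbdd A).trans_eq hA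

/-- **`0 ≤ ⟨f, τ₂f⟩` on the torus** (no zero modes of `∂` on `δ(Q_kA)δ_{k,Ax}`, gen 2; standing range, `w > 0`, `c ≠ 0`).
[cite: BalabanImbrieJaffe1985, (7.1.25) p.324] -/
theorem inner_tau2Torus_nonneg (hd : 2 ≤ P.d) {k : ℕ} (hk : k ≤ P.m + P.K) {w : ℝ} (hw : 0 < w) {c : ℝ} (hc : c ≠ 0)
    (f : UnitPlaqSpace P k) : 0 ≤ ⟪f, tau2Torus hd w c k f⟫ :=
  inner_tau2Op_nonneg (noZeroModes_V411_holds hk hw hc) _ f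

/-- `⟨f, τ₁f⟩ ≤ ⟨f, σ_kf⟩` on the torus. [cite: BalabanImbrieJaffe1985, (7.1.13) p.322] -/
theorem inner_tau1Torus_le_inner_sigmaTorus (hd : 2 ≤ P.d) {k : ℕ} (hk : k ≤ P.m + P.K) {w : ℝ} (hw : 0 < w) {c : ℝ}
    (hc : c ≠ 0) (f : UnitPlaqSpace P k) : ⟪f, tau1Torus hd w c k f⟫ ≤ ⟪f, sigmaTorus (P := P) hd w c k f⟫ :=
  inner_tau1Op_le_inner_sigmaOp (noZeroModes_V411_holds hk hw hc) _ f

/-- **τ₂ on the torus is the cost of the block constraint**: `⟨f, τ₂f⟩ = inf_{Q_kA = 0}‖∂A − Q^{e*}_kf‖²_η − inf_A‖∂A − Q^{e*}_kf‖²_η`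
(gen 4's `inner_sigmaTorus_eq_iInf`: the axial gauge already dropped). [cite: BalabanImbrieJaffe1985, (7.1.13) p.322] -/
theorem inner_tau2Torus_eq_iInf_sub_iInf (hd : 2 ≤ P.d) {k : ℕ} (hk : k ≤ P.m + P.K) {w : ℝ} (hw : 0 < w) {c : ℝ} (hc : c ≠ 0)
    (f : UnitPlaqSpace P k) :
    ⟪f, tau2Torus hd w c k f⟫ =
      (⨅ A : {A : VecField P 0 ℝ // bondAvgIter k A = 0}, ‖curlOp (P := P) w c (toE P A.1) - QesOp (P := P) hd w k f‖ ^ 2)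
        - ⨅ A : VecField P 0 ℝ, ‖curlOp (P := P) w c (toE P A) - QesOp (P := P) hd w k f‖ ^ 2 := by
  rw [← inner_sigmaTorus_eq_iInf hd hk hw hc, ← inner_tau1Torus_eq_iInf hd w c k]
  have h := inner_sigmaOp_eq_add (V411 P k) (curlOp (P := P) w c) (QesOp (P := P) hd w k) f
  change ⟪f, sigmaTorus (P := P) hd w c k f⟫ = ⟪f, tau1Torus hd w c k f⟫ + ⟪f, tau2Torus hd w c k f⟫ at h
  rw [h]
  ring

/-- **(7.1.31) on the tori, operator form**: `σ_k∂B = τ₂∂B`. [cite: BalabanImbrieJaffe1985, (7.1.31) p.325] -/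
theorem sigmaTorus_curl_eq_tau2Torus_curl (hd : 2 ≤ P.d) {k : ℕ} (hk : k ≤ P.m + P.K) (w c : ℝ) (B : PBond P k → ℝ) :
    sigmaTorus (P := P) hd w c k (toU P k (curl (c / (P.L : ℝ) ^ k) B)) = tau2Torus hd w c k (toU P k (curl (c / (P.L : ℝ) ^ k) B)) :=
  sigmaOp_apply_of_tau1_zero _ _ _ (tau1Torus_curl hd hk w c B)

/-- **(7.1.31) on the tori**: `⟨∂B, τ₂∂B⟩ = ⟨∂B, σ_k∂B⟩`. [cite: BalabanImbrieJaffe1985, (7.1.31) p.325] -/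
theorem inner_tau2Torus_curl (hd : 2 ≤ P.d) {k : ℕ} (hk : k ≤ P.m + P.K) (w c : ℝ) (B : PBond P k → ℝ) :
    ⟪toU P k (curl (c / (P.L : ℝ) ^ k) B), tau2Torus hd w c k (toU P k (curl (c / (P.L : ℝ) ^ k) B))⟫ =
      ⟪toU P k (curl (c / (P.L : ℝ) ^ k) B), sigmaTorus (P := P) hd w c k (toU P k (curl (c / (P.L : ℝ) ^ k) B))⟫ := by
  rw [sigmaTorus_curl_eq_tau2Torus_curl hd hk]

/-- **(7.1.31) verbatim on the tori**: *"⟨∂B, τ₂∂B⟩ = ⟨∂B, σ_k∂B⟩ = ⟨B, Δ_kB⟩, (7.1.31) using the definition (4.3.1) of Δ_k"* (Δ_k =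
p30's `deltaTorus`, via gen 2's `sigmaTorus_curl_eq_deltaTorus_holds`; `w > 0`, `c ≠ 0`). [cite: BalabanImbrieJaffe1985, (7.1.31) p.325] -/
theorem inner_tau2Torus_curl_eq_deltaTorus (hd : 2 ≤ P.d) {k : ℕ} (hk : k ≤ P.m + P.K) {w : ℝ} (hw : 0 < w) {c : ℝ} (hc : c ≠ 0)
    (B : PBond P k → ℝ) :
    ⟪toU P k (curl (c / (P.L : ℝ) ^ k) B), tau2Torus hd w c k (toU P k (curl (c / (P.L : ℝ) ^ k) B))⟫ = deltaTorus w c k B := by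
  rw [inner_tau2Torus_curl hd hk, sigmaTorus_curl_eq_deltaTorus_holds hd hk hw hc]

/-- **(7.1.25), first step, on the tori**: `⟨∂B + g, σ_k(∂B + g)⟩ = ⟨g, τ₁g⟩ + ⟨∂B + g, τ₂(∂B + g)⟩` for every unit plaquette field `g`.
[cite: BalabanImbrieJaffe1985, (7.1.25) p.324] -/
theorem eq7125_split_torus (hd : 2 ≤ P.d) {k : ℕ} (hk : k ≤ P.m + P.K) (w c : ℝ) (B : PBond P k → ℝ) (g : UnitPlaqSpace P k) :
    ⟪toU P k (curl (c / (P.L : ℝ) ^ k) B) + g, sigmaTorus (P := P) hd w c k (toU P k (curl (c / (P.L : ℝ) ^ k) B) + g)⟫ =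
      ⟪g, tau1Torus hd w c k g⟫
        + ⟪toU P k (curl (c / (P.L : ℝ) ^ k) B) + g, tau2Torus hd w c k (toU P k (curl (c / (P.L : ℝ) ^ k) B) + g)⟫ :=
  eq7125_split _ _ _ (tau1Torus_curl hd hk w c B) g

end Torus

end

end Literature.MathematicalPhysics.QuantumFieldTheory.BalabanImbrieJaffe1984to88.BIJ85Tau1Config717
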